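import Mathlib
import Literature.NumberTheory.Irrationality.Fischler2002.RhinViolaGroupsGeneral
import Literature.Analysis.SpecialFunctions.HypergeometricEulerTransformation
import HarnessLib

/-!
# Fischler 2002 §3: the hypergeometric transformation `χ` of the `n`-fold family `𝒥(p)` — PROVED for every `n ≥ 2`

Topic `Literature/NumberTheory/Irrationality/Fischler2002`; proofs-only companion of `RhinViolaGroupsGeneral.lean`, whose
NAMED FACT `Jn_chi` is DISCHARGED here as `Jn_chi_holds` (cell `pub-zeta5`, seat ct-1 g29, 2026-08-27). Source:
S. Fischler, « Formes linéaires en polyzêtas et intégrales multiples », C. R. Acad. Sci. Paris Sér. I **335** (2002) 1–4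
= arXiv:math/0202064 [Fischler2002Polyzetas], §3 p. 3: "notons `χ` l'automorphisme de `ℤ^{3n−1}` qui fixe toutes les
composantes, sauf `a_n` et `c_n` qu'il échange et `b_n` qu'il remplace par `a_n + b_n − c_n` ; il vérifie
`𝒥(p) = a_n! b_n!/(c_n! (a_n+b_n−c_n)!) · 𝒥(χ(p))` pour tout `p`" (journal version: S. Fischler, *Groupes de Rhin-Viola et
intégrales multiples*, J. Théor. Nombres Bordeaux **15** (2003) 479–534 [Fischler2003RhinViola], §4.2 Prop. 15, with the
hypotheses typed in `Jn_chi`).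

HONEST FRAMING (cells pub-zeta5 / zeta5-irr): systematic search; no irrationality claim unless certified. An identity between
(possibly infinite) `n`-fold integrals of non-negative functions; not an irrationality statement; nothing about `ζ(5)`.

## The proof (Euler's exchange in the last variable; no convergence hypothesis is used)
In `𝒥(p) = ∫_{[0,1]^n} ∏_k x_k^{a_k}(1−x_k)^{b_k} / ∏_{k=2}^n δ_k^{c_k} · dx/δ_n` the last variable `x_n` occurs only through
`x_n^{a_n}(1−x_n)^{b_n}/(1 − x_n δ_{n−1}(x′))^{c_n+1}` (`δ_n = 1 − x_n δ_{n−1}`), `x′ = (x₁,…,x_{n−1})`. Isolating `x_n`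
(`MeasurableEquiv.piFinSuccAbove` at `Fin.last`, measure preserving; Tonelli in `ℝ≥0∞`) the `x_n`-integral is, for every
`x′ ∈ (0,1)^{n−1}` (where `w = δ_{n−1}(x′) ∈ (0,1)`), Euler's integral
`∫₀¹ t^{a}(1−t)^{b}(1−wt)^{−c−1} dt = a! b!/(c! (a+b−c)!) ∫₀¹ t^{c}(1−t)^{a+b−c}(1−wt)^{−a−1} dt` (`euler_exchange`: the
`A ↔ B` symmetry of `₂F₁` read on Euler's integral representation — the tree's `Hypergeometric.eulerHypergeometric_symm` at
natural parameters; `eulerIntegrand_nat`, `eulerIntegrand_nat'`, `euler_exchange` are copied from the private ones of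
`RhinViola2001/GroupStructureProofs.lean`, where the same exchange proves Rhin–Viola's (4.1)), and the right-hand side is the
`x_n`-integral of `𝒥(χ(p))`. Of the typed hypotheses only `a_n, b_n, c_n, a_n+b_n−c_n ≥ 0` are used;
the identity then holds in `ℝ≥0∞`, finite or not. `[0,1]^n` is replaced by `(0,1)^n` up to a null set. Theorems only, no
definition, no new named fact (net debt −1).
-/

noncomputable section

namespace Literature.NumberTheory.Irrationality.Fischler2002

open MeasureTheory Set Finset intervalIntegral Literature.Analysis.SpecialFunctions.Hypergeometric
open scoped ENNReal Nat

namespace JnChi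

/-! ### Euler's exchange in one variable (copied from `RhinViola2001/GroupStructureProofs.lean`, private there) -/

/-- Euler's integrand at natural-number parameters `A = c+1`, `B = a+1`, `C = a+b+2` and real `w` is the real
function `x^a (1−x)^b / (1 − w x)^{c+1}`. [cite: Fischler2003RhinViola, §4.2 Proposition 15 (Euler's integral)] -/
theorem eulerIntegrand_nat (a b c : ℕ) (hc : c ≤ a + b) (w x : ℝ) :
    eulerIntegrand ((c : ℂ) + 1) ((a : ℂ) + 1) ((a : ℂ) + b + 2) (w : ℂ) x =
      ((x ^ a * (1 - x) ^ b / (1 - w * x) ^ (c + 1) : ℝ) : ℂ) := by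
  have _ := hc
  simp only [eulerIntegrand]
  have e1 : ((a : ℂ) + 1) - 1 = (a : ℂ) := by ring
  have e2 : ((a : ℂ) + b + 2) - ((a : ℂ) + 1) - 1 = (b : ℂ) := by ring
  have e3 : -((c : ℂ) + 1) = -((c + 1 : ℕ) : ℂ) := by push_cast; ring
  rw [e1, e2, e3, Complex.cpow_natCast, Complex.cpow_natCast, Complex.cpow_neg, Complex.cpow_natCast]
  push_cast
  ring

/-- The same with the roles of `A` and `B` exchanged: `x^c (1−x)^{a+b−c} / (1 − w x)^{a+1}`.
[cite: Fischler2003RhinViola, §4.2 Proposition 15 (Euler's integral)] -/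
theorem eulerIntegrand_nat' (a b c : ℕ) (hc : c ≤ a + b) (w x : ℝ) :
    eulerIntegrand ((a : ℂ) + 1) ((c : ℂ) + 1) ((a : ℂ) + b + 2) (w : ℂ) x =
      ((x ^ c * (1 - x) ^ (a + b - c) / (1 - w * x) ^ (a + 1) : ℝ) : ℂ) := by
  simp only [eulerIntegrand]
  have e1 : ((c : ℂ) + 1) - 1 = (c : ℂ) := by ring
  have e2 : ((a : ℂ) + b + 2) - ((c : ℂ) + 1) - 1 = ((a + b - c : ℕ) : ℂ) := by
    rw [Nat.cast_sub hc]; push_cast; ring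
  have e3 : -((a : ℂ) + 1) = -((a + 1 : ℕ) : ℂ) := by push_cast; ring
  rw [e1, e2, e3, Complex.cpow_natCast, Complex.cpow_natCast, Complex.cpow_neg, Complex.cpow_natCast]
  push_cast
  ring

/-- **Euler's exchange** (the `A ↔ B` symmetry of `₂F₁` read on Euler's integral): for `a, b, c ∈ ℕ` with
`c ≤ a + b` and real `w < 1`,
`c! (a+b−c)! ∫₀¹ x^a(1−x)^b/(1−wx)^{c+1} dx = a! b! ∫₀¹ x^c(1−x)^{a+b−c}/(1−wx)^{a+1} dx`.
[cite: Fischler2003RhinViola, §4.2 Proposition 15] [cite: Fischler2002Polyzetas, §3 p. 3 (formule pour χ)] -/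
theorem euler_exchange (a b c : ℕ) (hc : c ≤ a + b) {w : ℝ} (hw : w < 1) :
    ((c ! : ℝ) * ((a + b - c) ! : ℝ)) * ∫ x in (0:ℝ)..1, x ^ a * (1 - x) ^ b / (1 - w * x) ^ (c + 1) =
      ((a ! : ℝ) * (b ! : ℝ)) * ∫ x in (0:ℝ)..1, x ^ c * (1 - x) ^ (a + b - c) / (1 - w * x) ^ (a + 1) := by
  set L : ℝ := ∫ x in (0:ℝ)..1, x ^ a * (1 - x) ^ b / (1 - w * x) ^ (c + 1) with hLdef
  set R : ℝ := ∫ x in (0:ℝ)..1, x ^ c * (1 - x) ^ (a + b - c) / (1 - w * x) ^ (a + 1) with hRdef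
  have hA : 0 < ((c : ℂ) + 1).re := by simp; positivity
  have hAC : ((c : ℂ) + 1).re < ((a : ℂ) + b + 2).re := by
    simp
    have : (c : ℝ) ≤ (a : ℝ) + b := by exact_mod_cast hc
    linarith
  have hB : 0 < ((a : ℂ) + 1).re := by simp; positivity
  have hBC : ((a : ℂ) + 1).re < ((a : ℂ) + b + 2).re := by
    simp
    have : (0 : ℝ) ≤ b := by positivity
    linarith
  have hz : ((w : ℂ)).re < 1 := by simpa using hw
  have hsymm := eulerHypergeometric_symm hA hAC hB hBC hz
  unfold eulerHypergeometric eulerIntegral at hsymm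
  have hGC : Complex.Gamma ((a : ℂ) + b + 2) = (((a + b + 1) ! : ℕ) : ℂ) := by
    have : ((a : ℂ) + b + 2) = ((a + b + 1 : ℕ) : ℂ) + 1 := by push_cast; ring
    rw [this, Complex.Gamma_nat_eq_factorial]
  have hGB : Complex.Gamma ((a : ℂ) + 1) = ((a ! : ℕ) : ℂ) := Complex.Gamma_nat_eq_factorial a
  have hGA : Complex.Gamma ((c : ℂ) + 1) = ((c ! : ℕ) : ℂ) := Complex.Gamma_nat_eq_factorial c
  have hGCB : Complex.Gamma ((a : ℂ) + b + 2 - ((a : ℂ) + 1)) = ((b ! : ℕ) : ℂ) := by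
    have : ((a : ℂ) + b + 2 - ((a : ℂ) + 1)) = (b : ℂ) + 1 := by ring
    rw [this, Complex.Gamma_nat_eq_factorial]
  have hGCA : Complex.Gamma ((a : ℂ) + b + 2 - ((c : ℂ) + 1)) = (((a + b - c) ! : ℕ) : ℂ) := by
    have : ((a : ℂ) + b + 2 - ((c : ℂ) + 1)) = ((a + b - c : ℕ) : ℂ) + 1 := by
      rw [Nat.cast_sub hc]; push_cast; ring
    rw [this, Complex.Gamma_nat_eq_factorial]
  have hL : (∫ x in (0:ℝ)..1, eulerIntegrand ((c : ℂ) + 1) ((a : ℂ) + 1) ((a : ℂ) + b + 2) (w : ℂ) x) =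
      (L : ℂ) := by
    rw [hLdef, ← intervalIntegral.integral_ofReal]
    exact intervalIntegral.integral_congr fun x _ => eulerIntegrand_nat a b c hc w x
  have hR : (∫ x in (0:ℝ)..1, eulerIntegrand ((a : ℂ) + 1) ((c : ℂ) + 1) ((a : ℂ) + b + 2) (w : ℂ) x) =
      (R : ℂ) := by
    rw [hRdef, ← intervalIntegral.integral_ofReal]
    exact intervalIntegral.integral_congr fun x _ => eulerIntegrand_nat' a b c hc w x
  rw [hGC, hGB, hGA, hGCB, hGCA, hL, hR] at hsymm
  have hF : (((a + b + 1) ! : ℕ) : ℂ) ≠ 0 := Nat.cast_ne_zero.mpr (Nat.factorial_ne_zero _)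
  have ha : ((a ! : ℕ) : ℂ) ≠ 0 := Nat.cast_ne_zero.mpr (Nat.factorial_ne_zero _)
  have hb : ((b ! : ℕ) : ℂ) ≠ 0 := Nat.cast_ne_zero.mpr (Nat.factorial_ne_zero _)
  have hc' : ((c ! : ℕ) : ℂ) ≠ 0 := Nat.cast_ne_zero.mpr (Nat.factorial_ne_zero _)
  have hd : (((a + b - c) ! : ℕ) : ℂ) ≠ 0 := Nat.cast_ne_zero.mpr (Nat.factorial_ne_zero _)
  field_simp at hsymm
  have key' : (((a + b + 1) ! : ℕ) : ℂ) * (((c ! : ℕ) : ℂ) * (((a + b - c) ! : ℕ) : ℂ) * (L : ℂ)) =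
      (((a + b + 1) ! : ℕ) : ℂ) * (((a ! : ℕ) : ℂ) * ((b ! : ℕ) : ℂ) * (R : ℂ)) := by
    linear_combination ((((a + b + 1) ! : ℕ) : ℂ)) * hsymm
  have key := mul_left_cancel₀ hF key'
  exact_mod_cast key

/-- Euler's integrand `t^a(1−t)^b/(1−wt)^{c+1}` is non-negative on `[0,1]` for `w < 1`, `0 ≤ w`… in fact for every `w ≤ 1`
and `t ∈ [0,1]` since `1 − wt ≥ 1 − t ≥ 0`; we only need `0 ≤ w < 1`. [cite: Fischler2003RhinViola, §4.2 Proposition 15] -/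
theorem euler_den_pos {w t : ℝ} (hw0 : 0 ≤ w) (hw : w < 1) (ht1 : t ≤ 1) : 0 < 1 - w * t := by
  nlinarith [mul_le_mul_of_nonneg_left ht1 hw0]

/-- **Euler's exchange for lower Lebesgue integrals over `(0,1)`**: for `a, b, c ∈ ℕ`, `c ≤ a+b`, `0 ≤ w < 1`,
`∫⁻ ofReal(t^a(1−t)^b/(1−wt)^{c+1}) = ofReal(a!b!/(c!(a+b−c)!)) · ∫⁻ ofReal(t^c(1−t)^{a+b−c}/(1−wt)^{a+1})`.
[cite: Fischler2003RhinViola, §4.2 Proposition 15] -/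
theorem lintegral_euler_exchange (a b c : ℕ) (hc : c ≤ a + b) {w : ℝ} (hw0 : 0 ≤ w) (hw : w < 1) :
    ∫⁻ t in Ioo (0 : ℝ) 1, ENNReal.ofReal (t ^ a * (1 - t) ^ b / (1 - w * t) ^ (c + 1)) =
      ENNReal.ofReal (((a ! : ℝ) * (b ! : ℝ)) / ((c ! : ℝ) * ((a + b - c) ! : ℝ))) *
        ∫⁻ t in Ioo (0 : ℝ) 1, ENNReal.ofReal (t ^ c * (1 - t) ^ (a + b - c) / (1 - w * t) ^ (a + 1)) := by
  -- continuity and non-negativity on `[0,1]`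
  have hcont : ∀ (u v k : ℕ), ContinuousOn (fun t : ℝ => t ^ u * (1 - t) ^ v / (1 - w * t) ^ (k + 1))
      (uIcc (0 : ℝ) 1) := by
    intro u v k
    refine ContinuousOn.div (by fun_prop) (by fun_prop) fun t ht => ?_
    rw [Set.uIcc_of_le zero_le_one, Set.mem_Icc] at ht
    exact (pow_pos (euler_den_pos hw0 hw ht.2) _).ne'
  have hnn : ∀ (u v k : ℕ), ∀ t ∈ Ioo (0 : ℝ) 1, 0 ≤ t ^ u * (1 - t) ^ v / (1 - w * t) ^ (k + 1) := by
    intro u v k t ht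
    have h1 : 0 ≤ 1 - t := by linarith [ht.2]
    exact div_nonneg (mul_nonneg (pow_nonneg ht.1.le _) (pow_nonneg h1 _))
      (pow_nonneg (euler_den_pos hw0 hw ht.2.le).le _)
  have hI : ∀ (u v k : ℕ), ∫⁻ t in Ioo (0 : ℝ) 1, ENNReal.ofReal (t ^ u * (1 - t) ^ v / (1 - w * t) ^ (k + 1)) =
      ENNReal.ofReal (∫ t in (0 : ℝ)..1, t ^ u * (1 - t) ^ v / (1 - w * t) ^ (k + 1)) := by
    intro u v k
    rw [intervalIntegral.integral_of_le zero_le_one, integral_Ioc_eq_integral_Ioo,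
      ofReal_integral_eq_lintegral_ofReal]
    · exact (intervalIntegrable_iff_integrableOn_Ioo_of_le zero_le_one).1 (hcont u v k).intervalIntegrable
    · exact (ae_restrict_iff' measurableSet_Ioo).2 (Filter.Eventually.of_forall (hnn u v k))
  rw [hI, hI, ← ENNReal.ofReal_mul (by positivity)]
  congr 1
  have hE := euler_exchange a b c hc hw
  have hcd : ((c ! : ℝ) * ((a + b - c) ! : ℝ)) ≠ 0 := by positivity
  rw [div_mul_eq_mul_div, eq_div_iff hcd]
  linear_combination hE

/-! ### Coordinates of `Fin.snoc x′ t` and the nested `δ_k` -/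

/-- For `k ≤ m`, the `k`-th coordinate of `(x′, t) ∈ [0,1]^{m+1}` is that of `x′`. [cite: Fischler2002Polyzetas, §3 p. 3] -/
theorem coord_snoc_of_le {m : ℕ} (x' : Fin m → ℝ) (t : ℝ) {k : ℕ} (hk : k ≤ m) :
    coord (Fin.snoc x' t : Fin (m + 1) → ℝ) k = coord x' k := by
  unfold coord
  by_cases h1 : 1 ≤ k
  · have hA : 1 ≤ k ∧ k ≤ m + 1 := ⟨h1, by omega⟩
    have hB : 1 ≤ k ∧ k ≤ m := ⟨h1, hk⟩
    rw [dif_pos hA, dif_pos hB]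
    have hlt : k - 1 < m := by omega
    have : (⟨k - 1, by omega⟩ : Fin (m + 1)) = Fin.castSucc ⟨k - 1, hlt⟩ := rfl
    rw [this, Fin.snoc_castSucc]
  · rw [dif_neg (fun h => h1 h.1), dif_neg (fun h => h1 h.1)]

/-- The last coordinate of `(x′, t)` is `t`. [cite: Fischler2002Polyzetas, §3 p. 3] -/
theorem coord_snoc_last {m : ℕ} (x' : Fin m → ℝ) (t : ℝ) :
    coord (Fin.snoc x' t : Fin (m + 1) → ℝ) (m + 1) = t := by
  unfold coord
  rw [dif_pos ⟨by omega, le_rfl⟩]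
  have : (⟨m + 1 - 1, by omega⟩ : Fin (m + 1)) = Fin.last m := by
    ext; simp
  rw [this, Fin.snoc_last]

/-- For `k ≤ m`, `δ_k(x′, t) = δ_k(x′)`. [cite: Fischler2002Polyzetas, §1 p. 2 (definition of δ_k)] -/
theorem deltaV_snoc_of_le {m : ℕ} (x' : Fin m → ℝ) (t : ℝ) : ∀ {k : ℕ}, k ≤ m →
    deltaV (Fin.snoc x' t : Fin (m + 1) → ℝ) k = deltaV x' k
  | 0, _ => by simp [deltaV]
  | k + 1, hk => by
      rw [deltaV, deltaV, coord_snoc_of_le x' t hk, deltaV_snoc_of_le x' t (by omega)]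

/-- `δ_{m+1}(x′, t) = 1 − t·δ_m(x′)`. [cite: Fischler2002Polyzetas, §1 p. 2 (definition of δ_k)] -/
theorem deltaV_snoc_last {m : ℕ} (x' : Fin m → ℝ) (t : ℝ) :
    deltaV (Fin.snoc x' t : Fin (m + 1) → ℝ) (m + 1) = 1 - t * deltaV x' m := by
  rw [deltaV, coord_snoc_last, deltaV_snoc_of_le x' t le_rfl]

/-- On the open cube `0 < δ_k(x) < 1` for `1 ≤ k ≤ m` (and `δ₀ = 1`): by induction, `δ_k = 1 − x_kδ_{k−1}` with
`x_k ∈ (0,1)`, `δ_{k−1} ∈ (0,1]`. [cite: Fischler2002Polyzetas, §1 p. 2 (definition of δ_k)] -/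
theorem deltaV_mem {m : ℕ} {x : Fin m → ℝ} (hx : ∀ i, 0 < x i ∧ x i < 1) :
    ∀ k : ℕ, k ≤ m → 0 < deltaV x k ∧ deltaV x k ≤ 1 ∧ (1 ≤ k → deltaV x k < 1)
  | 0, _ => by simp [deltaV]
  | k + 1, hk => by
      obtain ⟨h0, h1, -⟩ := deltaV_mem hx k (by omega)
      have hc : 0 < coord x (k + 1) ∧ coord x (k + 1) < 1 := by
        unfold coord
        rw [dif_pos ⟨by omega, hk⟩]
        exact hx _
      rw [deltaV]
      refine ⟨?_, ?_, fun _ => ?_⟩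
      · nlinarith [mul_lt_mul'' hc.2 (lt_of_le_of_lt h1 (lt_add_one (1:ℝ))) hc.1.le h0.le, mul_le_of_le_one_right hc.1.le h1]
      · nlinarith [mul_pos hc.1 h0]
      · nlinarith [mul_pos hc.1 h0]

/-! ### Measurability of the integrand -/

/-- The coordinate functions are measurable. [cite: Fischler2002Polyzetas, §2 p. 2] -/
theorem measurable_coord {n : ℕ} (k : ℕ) : Measurable fun x : Fin n → ℝ => coord x k := by
  unfold coord
  by_cases h : 1 ≤ k ∧ k ≤ n
  · simp only [dif_pos h]; exact measurable_pi_apply _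
  · simp only [dif_neg h]; exact measurable_const

/-- The nested `δ_k` are measurable functions of `x`. [cite: Fischler2002Polyzetas, §1 p. 2 (definition of δ_k)] -/
theorem measurable_deltaV {n : ℕ} : ∀ k : ℕ, Measurable fun x : Fin n → ℝ => deltaV x k
  | 0 => by simp only [deltaV]; exact measurable_const
  | k + 1 => by
      have ih := measurable_deltaV (n := n) k
      have : (fun x : Fin n → ℝ => deltaV x (k + 1)) = fun x => 1 - coord x (k + 1) * deltaV x k := by
        funext x; rw [deltaV]
      rw [this]
      exact measurable_const.sub ((measurable_coord (k + 1)).mul ih)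

/-- The integrand of `𝒥(p)` is measurable (integer powers of measurable functions). [cite: Fischler2002Polyzetas, §3 p. 3] -/
theorem measurable_integrandJ (n : ℕ) (p : Exponents) : Measurable (integrandJ n p) := by
  unfold integrandJ
  refine ((Finset.measurable_prod _ fun k _ => ?_).div (Finset.measurable_prod _ fun k _ => ?_)).div
    (measurable_deltaV n)
  · exact ((measurable_coord k).pow_const _).mul ((measurable_const.sub (measurable_coord k)).pow_const _)
  · exact (measurable_deltaV k).pow_const _

/-! ### The integrand on a fibre of the last coordinate -/

/-- **Fibre form of the integrand**: for `n = m+1 ≥ 2`,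
`integrand(p)(x′, t) = G(x′) · t^{a_n}(1−t)^{b_n}/((1 − tδ_m(x′))^{c_n}(1 − tδ_m(x′)))` with
`G(x′) = ∏_{k≤m} x_k^{a_k}(1−x_k)^{b_k} / ∏_{2≤k≤m} δ_k^{c_k}` — the last variable enters only through `x_n^{a_n}(1−x_n)^{b_n}`
and `δ_n = 1 − x_nδ_{n−1}`. [cite: Fischler2002Polyzetas, §3 p. 3 (formule pour χ)] -/
theorem integrandJ_snoc {m : ℕ} (hm : 1 ≤ m) (p : Exponents) (x' : Fin m → ℝ) (t : ℝ) :
    integrandJ (m + 1) p (Fin.snoc x' t) =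
      ((∏ k ∈ Icc 1 m, coord x' k ^ p.a k * (1 - coord x' k) ^ p.b k) / (∏ k ∈ Icc 2 m, deltaV x' k ^ p.c k)) *
        (t ^ p.a (m + 1) * (1 - t) ^ p.b (m + 1) / ((1 - t * deltaV x' m) ^ p.c (m + 1) * (1 - t * deltaV x' m))) := by
  unfold integrandJ
  rw [Finset.prod_Icc_succ_top (by omega : 1 ≤ m + 1), Finset.prod_Icc_succ_top (by omega : 2 ≤ m + 1),
    coord_snoc_last, deltaV_snoc_last]
  have hP : ∏ k ∈ Icc 1 m, coord (Fin.snoc x' t : Fin (m + 1) → ℝ) k ^ p.a k *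
        (1 - coord (Fin.snoc x' t : Fin (m + 1) → ℝ) k) ^ p.b k =
      ∏ k ∈ Icc 1 m, coord x' k ^ p.a k * (1 - coord x' k) ^ p.b k :=
    Finset.prod_congr rfl fun k hk => by rw [coord_snoc_of_le x' t (Finset.mem_Icc.1 hk).2]
  have hD : ∏ k ∈ Icc 2 m, deltaV (Fin.snoc x' t : Fin (m + 1) → ℝ) k ^ p.c k = ∏ k ∈ Icc 2 m, deltaV x' k ^ p.c k :=
    Finset.prod_congr rfl fun k hk => by rw [deltaV_snoc_of_le x' t (Finset.mem_Icc.1 hk).2]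
  rw [hP, hD, div_div, mul_assoc, mul_div_mul_comm]

/-- The same for `χ(p)`: `G` is unchanged (χ moves only the `n`-th coordinates) and the last factor becomes
`t^{c_n}(1−t)^{a_n+b_n−c_n}/((1 − tδ_m(x′))^{a_n}(1 − tδ_m(x′)))`. [cite: Fischler2002Polyzetas, §3 p. 3 (définition de χ)] -/
theorem integrandJ_snoc_chi {m : ℕ} (hm : 1 ≤ m) (p : Exponents) (x' : Fin m → ℝ) (t : ℝ) :
    integrandJ (m + 1) (chi (m + 1) p) (Fin.snoc x' t) =
      ((∏ k ∈ Icc 1 m, coord x' k ^ p.a k * (1 - coord x' k) ^ p.b k) / (∏ k ∈ Icc 2 m, deltaV x' k ^ p.c k)) *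
        (t ^ p.c (m + 1) * (1 - t) ^ (p.a (m + 1) + p.b (m + 1) - p.c (m + 1)) /
          ((1 - t * deltaV x' m) ^ p.a (m + 1) * (1 - t * deltaV x' m))) := by
  rw [integrandJ_snoc hm]
  have hP : ∏ k ∈ Icc 1 m, coord x' k ^ (chi (m + 1) p).a k * (1 - coord x' k) ^ (chi (m + 1) p).b k =
      ∏ k ∈ Icc 1 m, coord x' k ^ p.a k * (1 - coord x' k) ^ p.b k :=
    Finset.prod_congr rfl fun k hk => by
      have hk' : k ≠ m + 1 := by have := (Finset.mem_Icc.1 hk).2; omega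
      simp [chi, hk']
  have hD : ∏ k ∈ Icc 2 m, deltaV x' k ^ (chi (m + 1) p).c k = ∏ k ∈ Icc 2 m, deltaV x' k ^ p.c k :=
    Finset.prod_congr rfl fun k hk => by
      have hk' : k ≠ m + 1 := by have := (Finset.mem_Icc.1 hk).2; omega
      simp [chi, hk']
  rw [hP, hD]
  simp [chi]

/-! ### Tonelli: the last coordinate innermost -/

/-- The open cube `(0,1)^n` is measurable. [cite: Fischler2002Polyzetas, §3 p. 3] -/
theorem measurableSet_openCube (n : ℕ) : MeasurableSet (Set.pi Set.univ fun _ : Fin n => Ioo (0 : ℝ) 1) :=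
  MeasurableSet.univ_pi fun _ => measurableSet_Ioo

/-- `(0,1)^n = [0,1]^n` up to a Lebesgue-null set. [cite: Fischler2002Polyzetas, §3 p. 3 (intégrales sur [0,1]^n)] -/
theorem openCube_ae_eq_unitCube (n : ℕ) : (Set.pi Set.univ fun _ : Fin n => Ioo (0 : ℝ) 1) =ᵐ[volume] unitCube n := by
  rw [unitCube, volume_pi]
  exact Measure.pi_Ioo_ae_eq_pi_Icc (f := fun _ => (0 : ℝ)) (g := fun _ => (1 : ℝ))

/-- **Tonelli with the last coordinate innermost**: for measurable `F ≥ 0` on `ℝ^{m+1}`,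
`∫⁻_{(0,1)^{m+1}} F = ∫⁻_{x′ ∈ (0,1)^m} ∫⁻_{t ∈ (0,1)} F(x′, t)` (the measure-preserving split
`MeasurableEquiv.piFinSuccAbove` at the last index, then Tonelli). [cite: Fischler2003RhinViola, §4.2 Proposition 15 (intégration en x_n)] -/
theorem lintegral_openCube_succ {m : ℕ} (F : (Fin (m + 1) → ℝ) → ℝ≥0∞) (hF : Measurable F) :
    ∫⁻ x in (Set.pi Set.univ fun _ : Fin (m + 1) => Ioo (0 : ℝ) 1), F x =
      ∫⁻ x' in (Set.pi Set.univ fun _ : Fin m => Ioo (0 : ℝ) 1), ∫⁻ t in Ioo (0 : ℝ) 1, F (Fin.snoc x' t) := by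
  have h1 : (volume : Measure (Fin (m + 1) → ℝ)).restrict (Set.pi Set.univ fun _ => Ioo (0 : ℝ) 1) =
      Measure.pi (fun _ : Fin (m + 1) => (volume : Measure ℝ).restrict (Ioo (0 : ℝ) 1)) := by
    rw [volume_pi, Measure.restrict_pi_pi]
  have h2 : (volume : Measure (Fin m → ℝ)).restrict (Set.pi Set.univ fun _ => Ioo (0 : ℝ) 1) =
      Measure.pi (fun _ : Fin m => (volume : Measure ℝ).restrict (Ioo (0 : ℝ) 1)) := by
    rw [volume_pi, Measure.restrict_pi_pi]
  rw [h1, h2]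
  set e := MeasurableEquiv.piFinSuccAbove (fun _ : Fin (m + 1) => ℝ) (Fin.last m) with he
  have hmp := measurePreserving_piFinSuccAbove (fun _ : Fin (m + 1) => (volume : Measure ℝ).restrict (Ioo (0 : ℝ) 1))
    (Fin.last m)
  rw [← hmp.symm.lintegral_comp_emb e.symm.measurableEmbedding F,
    lintegral_prod_symm (fun z => F (e.symm z)) ((hF.comp e.symm.measurable).aemeasurable)]
  refine lintegral_congr fun x' => lintegral_congr fun t => ?_
  have hsymm : e.symm (t, x') = Fin.snoc x' t := by
    rw [he, MeasurableEquiv.piFinSuccAbove_symm_apply]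
    simp [Fin.insertNthEquiv, Fin.insertNth_last']
  rw [hsymm]

end JnChi

open JnChi in
/-- **Fischler's hypergeometric transformation `χ` holds** (the named fact `Jn_chi` of `RhinViolaGroupsGeneral.lean` is a
theorem): for every `n ≥ 2` and `p` as typed, `𝒥(p) = a_n! b_n!/(c_n! (a_n+b_n−c_n)!) · 𝒥(χ(p))` — Euler's exchange in the
last variable `x_n` (of the typed hypotheses only `a_n, b_n, c_n, a_n+b_n−c_n ≥ 0` are used; the identity holds in `ℝ≥0∞`,
finite or not). [cite: Fischler2002Polyzetas, §3 p. 3 (formule pour χ)] [cite: Fischler2003RhinViola, §4.2 Proposition 15] -/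
theorem Jn_chi_holds : Jn_chi := by
  intro n p hn hcrit hc habc
  obtain ⟨m, rfl⟩ : ∃ m, n = m + 1 := ⟨n - 1, by omega⟩
  have hm : 1 ≤ m := by omega
  obtain ⟨ha_all, hb_all, -⟩ := hcrit
  have ha : 0 ≤ p.a (m + 1) := ha_all (m + 1) (Finset.mem_Icc.2 ⟨by omega, le_rfl⟩)
  have hb : 0 ≤ p.b (m + 1) := hb_all (m + 1) (Finset.mem_Icc.2 ⟨by omega, le_rfl⟩)
  obtain ⟨A, hA⟩ := Int.eq_ofNat_of_zero_le ha
  obtain ⟨B, hB⟩ := Int.eq_ofNat_of_zero_le hb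
  obtain ⟨C, hC⟩ := Int.eq_ofNat_of_zero_le hc
  have hCle : C ≤ A + B := by
    have : (C : ℤ) ≤ A + B := by rw [← hA, ← hB, ← hC]; linarith
    exact_mod_cast this
  -- the factorial ratio, in the form of `lintegral_euler_exchange`
  have hratio : ENNReal.ofReal (((p.a (m + 1)).toNat.factorial * (p.b (m + 1)).toNat.factorial : ℕ) /
        ((p.c (m + 1)).toNat.factorial * (p.a (m + 1) + p.b (m + 1) - p.c (m + 1)).toNat.factorial : ℕ)) =
      ENNReal.ofReal (((A ! : ℝ) * (B ! : ℝ)) / ((C ! : ℝ) * ((A + B - C) ! : ℝ))) := by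
    have hT : (p.a (m + 1) + p.b (m + 1) - p.c (m + 1)).toNat = A + B - C := by rw [hA, hB, hC]; omega
    rw [hT, hA, hB, hC]
    simp only [Int.toNat_natCast]
    push_cast
    ring_nf
  rw [hratio]
  -- pass to the open cube and split off the last coordinate
  unfold Jn
  rw [← setLIntegral_congr (openCube_ae_eq_unitCube (m + 1)),
    ← setLIntegral_congr (openCube_ae_eq_unitCube (m + 1)),
    lintegral_openCube_succ _ (measurable_integrandJ _ _).ennreal_ofReal,
    lintegral_openCube_succ _ (measurable_integrandJ _ _).ennreal_ofReal,
    ← lintegral_const_mul' _ _ ENNReal.ofReal_ne_top]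
  refine setLIntegral_congr_fun (measurableSet_openCube m) fun x' hx' => ?_
  -- on the fibre over `x′ ∈ (0,1)^m`
  have hx : ∀ i, 0 < x' i ∧ x' i < 1 := fun i => by
    have := hx' i (Set.mem_univ i); exact this
  obtain ⟨hw0, -, hw1⟩ := deltaV_mem hx m le_rfl
  have hw1' : deltaV x' m < 1 := hw1 hm
  set w := deltaV x' m with hwdef
  set G := (∏ k ∈ Icc 1 m, coord x' k ^ p.a k * (1 - coord x' k) ^ p.b k) /
      (∏ k ∈ Icc 2 m, deltaV x' k ^ p.c k) with hGdef
  have hG : 0 ≤ G := by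
    rw [hGdef]
    refine div_nonneg (Finset.prod_nonneg fun k hk => ?_) (Finset.prod_nonneg fun k hk => ?_)
    · have hck : 0 < coord x' k ∧ coord x' k < 1 := by
        unfold coord; rw [dif_pos (Finset.mem_Icc.1 hk)]; exact hx _
      exact mul_nonneg (zpow_pos hck.1 _).le (zpow_pos (by linarith [hck.2]) _).le
    · exact (zpow_pos (deltaV_mem hx k (Finset.mem_Icc.1 hk).2).1 _).le
  simp only [integrandJ_snoc_chi hm]
  simp only [integrandJ_snoc hm]
  rw [← hGdef, ← hwdef]
  -- integer exponents ↦ natural exponents, and the denominator as `(1 − w t)^{k+1}`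
  have hexpL : ∀ t : ℝ, G * (t ^ p.a (m + 1) * (1 - t) ^ p.b (m + 1) / ((1 - t * w) ^ p.c (m + 1) * (1 - t * w))) =
      G * (t ^ A * (1 - t) ^ B / (1 - w * t) ^ (C + 1)) := by
    intro t
    rw [hA, hB, hC, zpow_natCast, zpow_natCast, zpow_natCast, mul_comm t w, ← pow_succ]
  have hexpR : ∀ t : ℝ, G * (t ^ p.c (m + 1) * (1 - t) ^ (p.a (m + 1) + p.b (m + 1) - p.c (m + 1)) /
        ((1 - t * w) ^ p.a (m + 1) * (1 - t * w))) =
      G * (t ^ C * (1 - t) ^ (A + B - C) / (1 - w * t) ^ (A + 1)) := by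
    intro t
    have hT : p.a (m + 1) + p.b (m + 1) - p.c (m + 1) = ((A + B - C : ℕ) : ℤ) := by
      rw [hA, hB, hC, Nat.cast_sub hCle]; push_cast; ring
    rw [hT, hA, hC, zpow_natCast, zpow_natCast, zpow_natCast, mul_comm t w, ← pow_succ]
  simp only [hexpL, hexpR]
  -- pull `G` out and apply Euler's exchange in `t`
  simp only [ENNReal.ofReal_mul hG]
  rw [lintegral_const_mul' _ _ ENNReal.ofReal_ne_top, lintegral_const_mul' _ _ ENNReal.ofReal_ne_top,
    lintegral_euler_exchange A B C hCle hw0.le hw1']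
  ring

end Literature.NumberTheory.Irrationality.Fischler2002

end
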